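import Mathlib
import Summits.Schanuel.Schanuel.Theses.RigidCore
import Literature.NumberTheory.Transcendental.ExpPointsExamples
import Literature.NumberTheory.Transcendental.ExpPointsShapiroModel

/-!
# Line `puncture-log-analytic-rigidity` for crux `RigidCore.SparsityTwo` (stmt-Schanuel-0971)

Skeleton (crux-plan, round 1) of the idea card
`Cruxes/SparsityTwo/Ideas/puncture-log-analytic-rigidity.md` (triage r1: pass ×3).

ENGINE.  Write a ℚ-independent exponential point of `W` as a HIT: a point `(x, eˣ) ∈ W`.  Hits lie
in the modulus set `M_W = {p ∈ W : |y_i| = e^{Re x_i}}`.  On an irreducible curve hits are discrete,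
so infinitely many of them accumulate at a place at infinity of the curve, where each modulus curve
is a finite union of graphs `φ = 𝔊(r, r·log r)` with `𝔊` real-analytic at `(0,0)` (implicit function
theorem).  `stub_germRigidity` (a real-analytic germ on the transcendental arc `(r, r log r)` is `≡ 0`
or eventually zero-free) forces two such graphs carrying infinitely many common hits to COINCIDE:
the hits accumulate along a shared arc of `M_W` (`stub_hitsAccumulateOnSharedGerm`).  A shared arc
is an identity and identities classify (`stub_sharedGermClassification`, Schwarz reflection in the
abelian integrals `L_j = x_j − log y_j`, the repaired ModulusArcDichotomy with the axis inclusion made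
explicit): the curve is lattice-degenerate or `τ_c`-symmetric with the arc on the axis `2 Re x = c`.
For ℚ̄-curves `c = 0` (`stub_symmetricAlgebraicIsUnitary`: Hermite–Lindemann + Baker, tree facts
`transcendental_exp_holds`, `baker_holds`), so all but finitely many independent hits of a
non-degenerate irreducible ℚ̄-curve sit on the unitary axis `Re x = 0` of a unitary-symmetric
curve — the ATOM `stub_unitaryAxisAtoms` (= retired `ModulusFirst.UnitaryAxisFiniteness`, item
stmt-Schanuel-4147, in the coordinates `x = it`; the Shapiro/circle residue; OPEN, hardest).
`stub_rationalDecomposition` reduces a ℚ-closed `W` of dimension `< 2` to its finitely many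
non-degenerate geometrically irreducible ℚ̄-curve components (points and degenerate components carry
finitely many independent hits: `q·x = κ ∈ ℚ̄`, `y^q = e^κ`, Hermite–Lindemann) — this is where the
disprover's witnesses `expLineE` (not over ℚ̄), `expLineDep` (dependent hits, `κ = 0`) and
`expLineRat` (`e^c ∉ ℚ` for `c ∈ ℚˣ`) are honoured.

`sparsityTwo_of_stubs` is the kernel-checked, sorry-free composition of the six stub STATEMENTS; the skeleton
theorem `SparsityTwo_of : RigidCore.SparsityTwo` applies it to the stubs (no `sorry` outside the `stub_*`).
-/

namespace Summit.Schanuel.Schanuel.Cruxes.SparsityTwo.PunctureLogAnalyticRigidity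

open scoped BigOperators ComplexConjugate

/-- S1 · LOG-ANALYTIC GERM RIGIDITY (card's First lemma; provable now, ≈300 Mathlib lines; size M).
A real-analytic germ `H` at `(0,0) ∈ ℝ²` evaluated on the transcendental arc `r ↦ (r, r log r)`,
`r → 0⁺`, is either identically zero or zero-free on some `(0, ε)`: rearranging
`H(r, r log r) = Σ_n rⁿ P_n(log r)`, the first non-zero `r^{n₀} P_{n₀}(log r)` dominates the tail
`O(r^{n₀+1} |log r|^{n₀+1})`.  Definability-free replacement for o-minimality of `ℝ_an,exp` at a
place at infinity. -/
theorem stub_germRigidity :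
    (∀ H : ℝ × ℝ → ℝ, AnalyticAt ℝ H (0, 0) →
        (∃ ε > 0, ∀ r ∈ Set.Ioo (0 : ℝ) ε, H (r, r * Real.log r) = 0) ∨
        (∃ ε > 0, ∀ r ∈ Set.Ioo (0 : ℝ) ε, H (r, r * Real.log r) ≠ 0)) := by
  sorry

/-- S2 · HITS ACCUMULATE ONLY ALONG A SHARED MODULUS GERM (size L: needs local uniformisers at the
places at infinity of an affine curve — Laurent expansions of the coordinates — and the analytic
implicit function theorem `Literature.Analysis.Calculus.ImplicitChart.analyticAt_implicitFunction`).
Assuming S1: on a geometrically irreducible curve `W ⊂ ℂ² × ℂ²`, an infinite set `E` of exponential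
points is discrete in `W` (an accumulation point in `W` would make `e^{x_j} ≡ y_j` on `W`, forcing
`x` constant), hence accumulates at a place `p` at infinity where some `x_j` has a pole; there each
modulus curve `|y_j| = e^{Re x_j}` is a finite union of IFT graphs `φ = 𝔊_{j,ℓ}(r, r log r)`, the
hits near `p` lie on two such graphs, and S1 applied to `𝔊_{1,ℓ} − 𝔊_{2,ℓ'}` makes the graphs
coincide on `(0, ε)`: a non-trivial preconnected subset `C` of the modulus set `M_W` carrying
infinitely many points of `E`. -/
theorem stub_hitsAccumulateOnSharedGerm :
    ((∀ H : ℝ × ℝ → ℝ, AnalyticAt ℝ H (0, 0) →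
        (∃ ε > 0, ∀ r ∈ Set.Ioo (0 : ℝ) ε, H (r, r * Real.log r) = 0) ∨
        (∃ ε > 0, ∀ r ∈ Set.Ioo (0 : ℝ) ε, H (r, r * Real.log r) ≠ 0)) →
      (∀ (W : Set (Fin 2 ⊕ Fin 2 → ℂ)), Literature.NumberTheory.Transcendental.IsIrreducibleClosed ℂ W →
        Literature.NumberTheory.Transcendental.zariskiDim ℂ W = 1 →
        ∀ E : Set (Fin 2 → ℂ), E ⊆ {x | Sum.elim x (Complex.exp ∘ x) ∈ W} → E.Infinite →
          ∃ C ⊆ {p : Fin 2 ⊕ Fin 2 → ℂ | p ∈ W ∧ ∀ i, ‖p (Sum.inr i)‖ = Real.exp (p (Sum.inl i)).re},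
            IsPreconnected C ∧ C.Nontrivial ∧
            Set.Infinite {x : Fin 2 → ℂ | x ∈ E ∧ Sum.elim x (Complex.exp ∘ x) ∈ C})) := by
  sorry

/-- S3 · SHARED GERMS CLASSIFY (the repaired `ModulusFirst.ModulusArcDichotomy`, stmt-Schanuel-4148,
SHARPENED by the axis inclusion; size L: Schwarz reflection is not in Mathlib).  A non-trivial
preconnected `C ⊆ M_W` on a geometrically irreducible curve contains a real-analytic arc `A` on which
both abelian integrals `L_j = x_j − log y_j` are purely imaginary; with `ρ_A` the anti-holomorphic
reflection in `A`, `L_j ∘ ρ_A = −conj L_j` and `R = dL₂/dL₁ ∈ ℂ(W)` satisfies `R ∘ ρ_A = conj R`.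
(a) `R ≡ λ`: residues of `dy₂/y₂ − λ dy₁/y₁ = d(x₂ − λx₁)` vanish, so `λ ∈ ℚ` and
`e^{b x₂ − a x₁} ∈ ℂ(W)` forces `b x₂ − a x₁` constant (DEGENERATE), or `y` is constant and `W` is a
line of real slope (symmetric, `M_W` = its axis).  (b) `R` non-constant: `conj(x_j ∘ ρ_A)`,
`conj(y_j ∘ ρ_A)` are algebraic over `ℂ(R) ⊆ ℂ(W)` and `exp(x_j + x_j^ρ) = y_j y_j^ρ` in a function
field forces constants, so `ρ_A` is the ambient map `τ_c(x,y) = (c − x̄, e^c/ȳ)` restricted to `W`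
(triage r1-1 (iii) / r1-2: the correspondence is a graph — globalisation risk closed); `A ⊆ Fix τ_c`
forces `c ∈ ℝ²` and `A ⊆ {2 Re x = c}`; two symmetries `τ_c, τ_{c'}` compose to the translation by
`(c' − c, e^{c'−c})`, whose orbits are Zariski dense in a coordinate plane, so `c` is unique and every
arc of `M_W` — hence `C` — lies on the one axis. -/
theorem stub_sharedGermClassification :
    (∀ (W : Set (Fin 2 ⊕ Fin 2 → ℂ)), Literature.NumberTheory.Transcendental.IsIrreducibleClosed ℂ W →
        Literature.NumberTheory.Transcendental.zariskiDim ℂ W = 1 →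
        ∀ C ⊆ {p : Fin 2 ⊕ Fin 2 → ℂ | p ∈ W ∧ ∀ i, ‖p (Sum.inr i)‖ = Real.exp (p (Sum.inl i)).re},
          IsPreconnected C → C.Nontrivial →
            (∃ q : Fin 2 → ℤ, q ≠ 0 ∧ ∃ κ : ℂ, ∀ p ∈ W, ∑ i, (q i : ℂ) * p (Sum.inl i) = κ) ∨
            (∃ c : Fin 2 → ℝ, (∀ p ∈ W, (∀ i, p (Sum.inr i) ≠ 0) →
          Sum.elim (fun i => ((c i : ℂ)) - (starRingEnd ℂ) (p (Sum.inl i)))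
            (fun i => (Real.exp (c i) : ℂ) / (starRingEnd ℂ) (p (Sum.inr i))) ∈ W) ∧
              ∀ p ∈ C, ∀ i, 2 * (p (Sum.inl i)).re = c i)) := by
  sorry

/-- S4 · SYMMETRIC ℚ̄-CURVES ARE UNITARY-SYMMETRIC (= `ModulusFirst.SymmetricAlgebraicIsUnitary`,
stmt-Schanuel-4151, signature verbatim; size M over the PROVED tree facts
`Literature.NumberTheory.Transcendental.transcendental_exp_holds` (Hermite–Lindemann) and
`Literature.NumberTheory.Transcendental.baker_holds`).  The parameters `(a, b)` with
`(x, y) ↦ (a − x̄, b/ȳ)` mapping `W°` into `W` form a ℚ̄-closed coset of the translation–dilation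
stabiliser of `W`; finite stabiliser ⇒ `(c, e^c) ∈ ℚ̄² × ℚ̄²` ⇒ `c = 0` (H–L); infinite stabiliser ⇒
`W = {y = β} × (line of real irrational algebraic slope)` and `log|β₂| − λ log|β₁| ∈ ℚ̄` ⇒ `|β| = 1`,
`c = 0` (Baker + H–L).  THIS is where ℚ̄-definedness is consumed on the symmetric side
(disprover: `SparsityTwo` is false for `expLineE`, defined over `ℚ(e)`). -/
theorem stub_symmetricAlgebraicIsUnitary :
    (∀ (W : Set (Fin 2 ⊕ Fin 2 → ℂ)), Literature.NumberTheory.Transcendental.IsIrreducibleClosed ℂ W →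
        Literature.NumberTheory.Transcendental.zariskiDim ℂ W = 1 →
        Literature.NumberTheory.Transcendental.IsDefinedOver (algebraicClosure ℚ ℂ).toSubfield W →
        ¬ (∃ q : Fin 2 → ℤ, q ≠ 0 ∧ ∃ κ : ℂ, ∀ p ∈ W, ∑ i, (q i : ℂ) * p (Sum.inl i) = κ) →
        (∃ p ∈ W, ∀ i, p (Sum.inr i) ≠ 0) →
        ∀ c : Fin 2 → ℝ, (∀ p ∈ W, (∀ i, p (Sum.inr i) ≠ 0) →
          Sum.elim (fun i => ((c i : ℂ)) - (starRingEnd ℂ) (p (Sum.inl i)))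
            (fun i => (Real.exp (c i) : ℂ) / (starRingEnd ℂ) (p (Sum.inr i))) ∈ W) → c = 0) := by
  sorry

/-- S5 · THE ATOM — UNITARY-AXIS FINITENESS (= `ModulusFirst.UnitaryAxisFiniteness`, stmt-Schanuel-4147,
written in the coordinates `x = it`, `t ∈ ℝ²`, i.e. `Re x = 0`; OPEN — the HARDEST stub; SC(2)
predicts the set is empty).  For a non-degenerate geometrically irreducible ℚ̄-curve invariant under
`τ₀(x, y) = (−x̄, 1/ȳ)`, only finitely many ℚ-independent `x ∈ (iℝ)²` have `(x, eˣ) ∈ W`: the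
circle/Shapiro residue (common zeros of exponential polynomials on the unitary axis; e.g. the cubic
Cayley pair `{x₂³ = 2x₁³, (1 − x_j)(y_j + 1) = 2}` of triage r1-2).  Known sub-classes: constant `y`
(Baker: route supports `RigidCore.OneLogBranchRelationFinite` / `TwoLogsBranchRelationFinite`),
real-quadratic slope with torsion phases (Theorem P / `NormDescentTwo` of card
galois-norm-branch-defect), depth ≥ 2 cusps (cards cusp-germ-schneider-sparsity,
resonance-depth-roth-sieve).  The lead splits THIS stub; everything else in the line is a theorem. -/
theorem stub_unitaryAxisAtoms :
    (∀ (W : Set (Fin 2 ⊕ Fin 2 → ℂ)), Literature.NumberTheory.Transcendental.IsIrreducibleClosed ℂ W →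
        Literature.NumberTheory.Transcendental.zariskiDim ℂ W = 1 →
        Literature.NumberTheory.Transcendental.IsDefinedOver (algebraicClosure ℚ ℂ).toSubfield W →
        ¬ (∃ q : Fin 2 → ℤ, q ≠ 0 ∧ ∃ κ : ℂ, ∀ p ∈ W, ∑ i, (q i : ℂ) * p (Sum.inl i) = κ) →
        (∀ p ∈ W, (∀ i, p (Sum.inr i) ≠ 0) →
          Sum.elim (fun i => -(starRingEnd ℂ) (p (Sum.inl i)))
            (fun i => ((starRingEnd ℂ) (p (Sum.inr i)))⁻¹) ∈ W) →
        Set.Finite {x : Fin 2 → ℂ | LinearIndependent ℚ x ∧ (∀ i, (x i).re = 0) ∧ Sum.elim x (Complex.exp ∘ x) ∈ W}) := by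
  sorry

/-- S6 · RATIONAL DECOMPOSITION (size M/L: irreducible decomposition of a ℚ-closed set, components are
defined over ℚ̄, plus Hermite–Lindemann `transcendental_exp_holds` on degenerate components).  A
Zariski-closed `W ⊂ ℂ² × ℂ²` defined over ℚ with `zariskiDim W < 2` is a finite union of ℚ̄-points and
geometrically irreducible ℚ̄-curves; a DEGENERATE curve component (`q·x = κ` on it, `q ∈ ℤ² ∖ 0`,
so `κ ∈ ℚ̄`) carries only finitely many ℚ-independent hits: on hits `y^q = e^κ`; either `y^q` is
non-constant on the component (a proper closed condition: finitely many points) or `y^q ≡ μ ∈ ℚ̄`,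
and then hits exist only if `e^κ = μ`, i.e. `κ = 0` by Hermite–Lindemann, i.e. every hit is
ℚ-DEPENDENT (the disprover's `expLineDep` witnesses; `expLineRat`/`expLineE` show the ℚ̄ input is
necessary).  Output: finitely many non-degenerate irreducible ℚ̄-curves `W' ⊆ W` outside which `W`
has only finitely many independent hits. -/
theorem stub_rationalDecomposition :
    (∀ (W : Set (Fin 2 ⊕ Fin 2 → ℂ)), Literature.NumberTheory.Transcendental.IsDefinedOver (⊥ : Subfield ℂ) W →
        Literature.NumberTheory.Transcendental.zariskiDim ℂ W < 2 →
        ∃ S : Set (Set (Fin 2 ⊕ Fin 2 → ℂ)), S.Finite ∧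
          (∀ W' ∈ S, W' ⊆ W ∧ Literature.NumberTheory.Transcendental.IsIrreducibleClosed ℂ W' ∧ Literature.NumberTheory.Transcendental.zariskiDim ℂ W' = 1 ∧
            Literature.NumberTheory.Transcendental.IsDefinedOver (algebraicClosure ℚ ℂ).toSubfield W' ∧
            ¬ (∃ q : Fin 2 → ℤ, q ≠ 0 ∧ ∃ κ : ℂ, ∀ p ∈ W', ∑ i, (q i : ℂ) * p (Sum.inl i) = κ)) ∧
          Set.Finite {x : Fin 2 → ℂ | LinearIndependent ℚ x ∧ Sum.elim x (Complex.exp ∘ x) ∈ W ∧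
            ∀ W' ∈ S, Sum.elim x (Complex.exp ∘ x) ∉ W'}) := by
  sorry

/-- COMPOSITION, hypotheses form (pure logic, kernel-checked, sorry-free): the six stub STATEMENTS imply
the definiens of the crux.  Per non-degenerate irreducible ℚ̄-curve `W'`: infinitely many independent hits
⇒ (S2, fed by S1) an arc `C ⊆ M_{W'}` carrying infinitely many of them ⇒ (S3) `W'` degenerate — excluded —
or `τ_c`-symmetric with `C` on the axis `2 Re x = c` ⇒ (S4) `c = 0` ⇒ those hits are unitary-axis hits,
finite by S5 — contradiction.  S6 assembles: the independent hits of `W` lie in a finite set or on one of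
finitely many such `W'`.  (The conclusion is spelled out rather than named so that exactly ONE theorem of
this file, `SparsityTwo_of` below, concludes the crux by name — the skeleton audit's layer invariant.) -/
theorem sparsityTwo_of_stubs
    (h1 : (∀ H : ℝ × ℝ → ℝ, AnalyticAt ℝ H (0, 0) →
        (∃ ε > 0, ∀ r ∈ Set.Ioo (0 : ℝ) ε, H (r, r * Real.log r) = 0) ∨
        (∃ ε > 0, ∀ r ∈ Set.Ioo (0 : ℝ) ε, H (r, r * Real.log r) ≠ 0)))
    (h2 : ((∀ H : ℝ × ℝ → ℝ, AnalyticAt ℝ H (0, 0) →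
        (∃ ε > 0, ∀ r ∈ Set.Ioo (0 : ℝ) ε, H (r, r * Real.log r) = 0) ∨
        (∃ ε > 0, ∀ r ∈ Set.Ioo (0 : ℝ) ε, H (r, r * Real.log r) ≠ 0)) →
      (∀ (W : Set (Fin 2 ⊕ Fin 2 → ℂ)), Literature.NumberTheory.Transcendental.IsIrreducibleClosed ℂ W →
        Literature.NumberTheory.Transcendental.zariskiDim ℂ W = 1 →
        ∀ E : Set (Fin 2 → ℂ), E ⊆ {x | Sum.elim x (Complex.exp ∘ x) ∈ W} → E.Infinite →
          ∃ C ⊆ {p : Fin 2 ⊕ Fin 2 → ℂ | p ∈ W ∧ ∀ i, ‖p (Sum.inr i)‖ = Real.exp (p (Sum.inl i)).re},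
            IsPreconnected C ∧ C.Nontrivial ∧
            Set.Infinite {x : Fin 2 → ℂ | x ∈ E ∧ Sum.elim x (Complex.exp ∘ x) ∈ C})))
    (h3 : (∀ (W : Set (Fin 2 ⊕ Fin 2 → ℂ)), Literature.NumberTheory.Transcendental.IsIrreducibleClosed ℂ W →
        Literature.NumberTheory.Transcendental.zariskiDim ℂ W = 1 →
        ∀ C ⊆ {p : Fin 2 ⊕ Fin 2 → ℂ | p ∈ W ∧ ∀ i, ‖p (Sum.inr i)‖ = Real.exp (p (Sum.inl i)).re},
          IsPreconnected C → C.Nontrivial →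
            (∃ q : Fin 2 → ℤ, q ≠ 0 ∧ ∃ κ : ℂ, ∀ p ∈ W, ∑ i, (q i : ℂ) * p (Sum.inl i) = κ) ∨
            (∃ c : Fin 2 → ℝ, (∀ p ∈ W, (∀ i, p (Sum.inr i) ≠ 0) →
          Sum.elim (fun i => ((c i : ℂ)) - (starRingEnd ℂ) (p (Sum.inl i)))
            (fun i => (Real.exp (c i) : ℂ) / (starRingEnd ℂ) (p (Sum.inr i))) ∈ W) ∧
              ∀ p ∈ C, ∀ i, 2 * (p (Sum.inl i)).re = c i)))
    (h4 : (∀ (W : Set (Fin 2 ⊕ Fin 2 → ℂ)), Literature.NumberTheory.Transcendental.IsIrreducibleClosed ℂ W →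
        Literature.NumberTheory.Transcendental.zariskiDim ℂ W = 1 →
        Literature.NumberTheory.Transcendental.IsDefinedOver (algebraicClosure ℚ ℂ).toSubfield W →
        ¬ (∃ q : Fin 2 → ℤ, q ≠ 0 ∧ ∃ κ : ℂ, ∀ p ∈ W, ∑ i, (q i : ℂ) * p (Sum.inl i) = κ) →
        (∃ p ∈ W, ∀ i, p (Sum.inr i) ≠ 0) →
        ∀ c : Fin 2 → ℝ, (∀ p ∈ W, (∀ i, p (Sum.inr i) ≠ 0) →
          Sum.elim (fun i => ((c i : ℂ)) - (starRingEnd ℂ) (p (Sum.inl i)))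
            (fun i => (Real.exp (c i) : ℂ) / (starRingEnd ℂ) (p (Sum.inr i))) ∈ W) → c = 0))
    (h5 : (∀ (W : Set (Fin 2 ⊕ Fin 2 → ℂ)), Literature.NumberTheory.Transcendental.IsIrreducibleClosed ℂ W →
        Literature.NumberTheory.Transcendental.zariskiDim ℂ W = 1 →
        Literature.NumberTheory.Transcendental.IsDefinedOver (algebraicClosure ℚ ℂ).toSubfield W →
        ¬ (∃ q : Fin 2 → ℤ, q ≠ 0 ∧ ∃ κ : ℂ, ∀ p ∈ W, ∑ i, (q i : ℂ) * p (Sum.inl i) = κ) →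
        (∀ p ∈ W, (∀ i, p (Sum.inr i) ≠ 0) →
          Sum.elim (fun i => -(starRingEnd ℂ) (p (Sum.inl i)))
            (fun i => ((starRingEnd ℂ) (p (Sum.inr i)))⁻¹) ∈ W) →
        Set.Finite {x : Fin 2 → ℂ | LinearIndependent ℚ x ∧ (∀ i, (x i).re = 0) ∧ Sum.elim x (Complex.exp ∘ x) ∈ W}))
    (h6 : (∀ (W : Set (Fin 2 ⊕ Fin 2 → ℂ)), Literature.NumberTheory.Transcendental.IsDefinedOver (⊥ : Subfield ℂ) W →
        Literature.NumberTheory.Transcendental.zariskiDim ℂ W < 2 →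
        ∃ S : Set (Set (Fin 2 ⊕ Fin 2 → ℂ)), S.Finite ∧
          (∀ W' ∈ S, W' ⊆ W ∧ Literature.NumberTheory.Transcendental.IsIrreducibleClosed ℂ W' ∧ Literature.NumberTheory.Transcendental.zariskiDim ℂ W' = 1 ∧
            Literature.NumberTheory.Transcendental.IsDefinedOver (algebraicClosure ℚ ℂ).toSubfield W' ∧
            ¬ (∃ q : Fin 2 → ℤ, q ≠ 0 ∧ ∃ κ : ℂ, ∀ p ∈ W', ∑ i, (q i : ℂ) * p (Sum.inl i) = κ)) ∧
          Set.Finite {x : Fin 2 → ℂ | LinearIndependent ℚ x ∧ Sum.elim x (Complex.exp ∘ x) ∈ W ∧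
            ∀ W' ∈ S, Sum.elim x (Complex.exp ∘ x) ∉ W'})) :
    ∀ (W : Set (Fin 2 ⊕ Fin 2 → ℂ)), Literature.NumberTheory.Transcendental.IsDefinedOver (⊥ : Subfield ℂ) W →
      Literature.NumberTheory.Transcendental.zariskiDim ℂ W < 2 →
      Set.Finite {x : Fin 2 → ℂ | LinearIndependent ℚ x ∧ Sum.elim x (Complex.exp ∘ x) ∈ W} := by
  intro W hW hdim
  obtain ⟨S, hSfin, hS, hrest⟩ := h6 W hW hdim
  -- finiteness on each non-degenerate irreducible ℚ̄-curve of the decomposition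
  have hcurve : ∀ W' ∈ S,
      Set.Finite {x : Fin 2 → ℂ | LinearIndependent ℚ x ∧ Sum.elim x (Complex.exp ∘ x) ∈ W'} := by
    intro W' hW'S
    obtain ⟨-, hirr, hdim1, hdef, hndeg⟩ := hS W' hW'S
    by_contra hinf
    obtain ⟨C, hCsub, hCconn, hCnt, hCinf⟩ :=
      h2 h1 W' hirr hdim1 {x : Fin 2 → ℂ | LinearIndependent ℚ x ∧ Sum.elim x (Complex.exp ∘ x) ∈ W'}
        (fun x hx => hx.2) hinf
    rcases h3 W' hirr hdim1 C hCsub hCconn hCnt with hdeg | ⟨c, hsym, haxis⟩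
    · exact hndeg hdeg
    · obtain ⟨p, hpC⟩ := hCnt.nonempty
      have hpM := hCsub hpC
      have hp0 : ∀ i, p (Sum.inr i) ≠ 0 := by
        intro i hzero
        have hnorm := hpM.2 i
        rw [hzero, norm_zero] at hnorm
        exact (Real.exp_pos _).ne hnorm
      have hc : c = 0 := h4 W' hirr hdim1 hdef hndeg ⟨p, hpM.1, hp0⟩ c hsym
      subst hc
      have hsym0 : (∀ p ∈ W', (∀ i, p (Sum.inr i) ≠ 0) →
          Sum.elim (fun i => -(starRingEnd ℂ) (p (Sum.inl i)))
            (fun i => ((starRingEnd ℂ) (p (Sum.inr i)))⁻¹) ∈ W') := by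
        intro p hp hp0'
        have key :
            (Sum.elim (fun i => (((0 : Fin 2 → ℝ) i : ℂ)) - (starRingEnd ℂ) (p (Sum.inl i)))
              (fun i => (Real.exp ((0 : Fin 2 → ℝ) i) : ℂ) / (starRingEnd ℂ) (p (Sum.inr i))) :
                Fin 2 ⊕ Fin 2 → ℂ) =
            Sum.elim (fun i => -(starRingEnd ℂ) (p (Sum.inl i)))
              (fun i => ((starRingEnd ℂ) (p (Sum.inr i)))⁻¹) := by
          funext j
          rcases j with i | i
          · simp
          · simp
        rw [← key]
        exact hsym p hp hp0'
      have hfin := h5 W' hirr hdim1 hdef hndeg hsym0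
      refine hCinf (hfin.subset ?_)
      rintro x ⟨⟨hxli, hxW'⟩, hxC⟩
      refine ⟨hxli, fun i => ?_, hxW'⟩
      have h2re := haxis _ hxC i
      simp only [Sum.elim_inl, Pi.zero_apply] at h2re
      linarith
  -- assemble over the decomposition
  have hcover :
      {x : Fin 2 → ℂ | LinearIndependent ℚ x ∧ Sum.elim x (Complex.exp ∘ x) ∈ W} ⊆
        {x : Fin 2 → ℂ | LinearIndependent ℚ x ∧ Sum.elim x (Complex.exp ∘ x) ∈ W ∧ ∀ W' ∈ S, Sum.elim x (Complex.exp ∘ x) ∉ W'} ∪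
          ⋃ W' ∈ S, {x : Fin 2 → ℂ | LinearIndependent ℚ x ∧ Sum.elim x (Complex.exp ∘ x) ∈ W'} := by
    rintro x ⟨hxli, hxW⟩
    by_cases hout : ∀ W' ∈ S, Sum.elim x (Complex.exp ∘ x) ∉ W'
    · exact Or.inl ⟨hxli, hxW, hout⟩
    · push Not at hout
      obtain ⟨W', hW'S, hxW'⟩ := hout
      exact Or.inr (Set.mem_biUnion hW'S ⟨hxli, hxW'⟩)
  exact (hrest.union (hSfin.biUnion hcurve)).subset hcover

/-- THE SKELETON THEOREM: concludes the crux `Summit.Schanuel.Schanuel.Theses.RigidCore.SparsityTwo`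
BY NAME from the six declared stubs and nothing else (kernel-checked; its only non-standard axiom is the
`sorryAx` inside the `stub_*`, which disappears as the stubs land). -/
theorem SparsityTwo_of : Summit.Schanuel.Schanuel.Theses.RigidCore.SparsityTwo := by
  intro W hW hdim
  exact sparsityTwo_of_stubs stub_germRigidity stub_hitsAccumulateOnSharedGerm
    stub_sharedGermClassification stub_symmetricAlgebraicIsUnitary stub_unitaryAxisAtoms
    stub_rationalDecomposition W hW hdim

end Summit.Schanuel.Schanuel.Cruxes.SparsityTwo.PunctureLogAnalyticRigidity
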